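import Summits.CriticalPhenomena.PercolationContinuityZ3.Theorems.FK.DomainMarkovForcedWiring
import Summits.CriticalPhenomena.PercolationContinuityZ3.Theorems.FK.InfiniteVolumeDLRFinite
import HarnessLib

/-!
# FK-continuity transplant, FO-10 (domain-Markov toolkit, seat A): histories that force a wiring — the summed
# finite-volume sandwich, and the transport of an edge-set region of `ℤ^d` into a larger piece

Cell `fk-continuity` (bschramm), row FO-10a; support file for the FK-continuity transplant
(`--supports stmt-CriticalPhenomena-4575`); builds on p205010 (kernel theorem, internal audit signed; external
expert review pending).  Pure proofs; no definitions, no named facts, no sorries.  Companion of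
`DomainMarkovForcedWiring.lean` (the per-cylinder domination crediting a forced wiring, Grimmett 2006 Lemma (4.13)
with Lemma (4.14)(b)); the infinite-volume statements over the box limits are `DomainMarkovForcedWiringLimit.lean`.

## Contents

* `rcMeasure_fromEdgeSet_real_mul_le_real_inter_of_reachable` /
  `rcMeasure_real_inter_le_fromEdgeSet_real_mul_of_isLowerSet_of_reachable` — finite volume, any finite graph:
  for a region `U ⊆ E(G)`, an event `S` determined off `U` all of whose (non-null) patterns `ξ` join the seed `W₀`
  in `⟨ξ⟩ ∨ K_B`, an increasing `A` / decreasing `D` determined by `U`: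
  `φ^{W₀}_{⟨U⟩,p,q}(A) · φ^B_G(S) ≤ φ^B_G(A ∩ S)` and `φ^B_G(D ∩ S) ≤ φ^{W₀}_{⟨U⟩,p,q}(D) · φ^B_G(S)`
  (FO-06a's `rcMeasure_fromEdgeSet_real_mul_le_real_inter` is `W₀ = B`, no credit for the history).
* `rcMeasure_fromEdgeSet_edgeFinset_real` — `φ^W_{⟨E(G)⟩} = φ^W_G` (the spanning graph of all edges).
* An EDGE-SET REGION of `ℤ^d`: a finite vertex piece `Λ` and a set `R` of edges of `(Λ, E_Λ)` (the FRESH edges;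
  their lattice images form `F ⊆ E_Λ`), its law `φ^W_{⟨R⟩,p,q} = rcMeasure (fromEdgeSet ↑R) p q W` on `Λ` with a
  seed `W ⊆ Λ` wired, read on `ℤ^d` through `liftEdges Λ`.  This is the generality exploration arguments need (Kozma–Nitzan:
  the seed cube sits INSIDE the box, its revealed-open edges are excised from the fresh region and its vertices
  wired), and it contains the vertex-induced regions `R = E_Λ` of FO-06a's interface.  Bookkeeping:
  `mem_edgeFinset_finsetGraph_iff`, `map_val_edgeLift`, `map_edgeLift_subset_edgeFinset`,
  `mem_map_edgeLift_of_map_val_mem`, and the TRANSPORT `rcMeasure_fromEdgeSet_map_edgeLift_real`: inside a larger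
  piece `Δ ⊇ Λ` the law of the lifted region `R.map (edgeLift h)` with the copy of `W` wired agrees with
  `φ^W_{⟨R⟩,p,q}` on pulled-back events (tree `rcMeasure_real_map_image`; FO-06a did `R = E_Λ`, `W = ∅`).
* `reachable_of_mem_openConn_liftEdges` — an open path of `ℤ^d` in a lifted configuration pulls back to the piece.

## References

* G. Grimmett, *The Random-Cluster Model*, Springer 2006: §4.2 (4.11)–(4.13), Lemma (4.13) p. 70, Lemma (4.14)(b)
  p. 71 (proof p. 72–73). [Grimmett2006]
-/

noncomputable section

open MeasureTheory Set Filter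
open scoped Topology ENNReal

namespace Summit.CriticalPhenomena.PercolationContinuityZ3.Theorems.FK

open Literature.Probability.Percolation Literature.Probability.LatticeModels

section Finite

open Finset SimpleGraph

variable {V : Type*} [Fintype V] [DecidableEq V] (G : SimpleGraph V) [DecidableRel G.Adj]

/-! ### Summed over a history all of whose patterns join the seed -/

/-- **Lower sandwich crediting history-forced wiring** (Grimmett 2006, Lemma (4.13) with Lemma (4.14)(b),
summed over the cylinders off the region): for a region `U ⊆ E(G)`, an increasing event `A` determined by the
edges of `U`, and an event `S` determined by the pairs off `U` such that every pattern `ξ ⊆ E(G)` off `U` lying in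
`S` joins all of `W₀` in `⟨ξ⟩ ∨ K_B` (the history guarantees that the seed `W₀` is wired, through revealed open
edges and the ambient wiring `B`): `φ^{W₀}_{⟨U⟩,p,q}(A) · φ^B_{G,p,q}(S) ≤ φ^B_{G,p,q}(A ∩ S)` (`q ≥ 1`).
FO-06a's `rcMeasure_fromEdgeSet_real_mul_le_real_inter` is the case `W₀ = B` (no credit for the history).
[cite: Grimmett2006, Lemma (4.13) and Lemma (4.14)(b)] -/
theorem rcMeasure_fromEdgeSet_real_mul_le_real_inter_of_reachable {p q : ℝ} (hp : p ∈ Set.Icc (0 : ℝ) 1)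
    (hq : 1 ≤ q) (B : Set V) (U : Finset (Sym2 V)) (hU : U ⊆ G.edgeFinset) {W₀ : Set V}
    {A S : Set (BondConfig V)} (hA : IsUpperSet A) (hAU : ∀ ω, ω ∈ A ↔ ω ∩ ↑U ∈ A)
    (hS : ∀ ω, ω ∈ S ↔ ω ∩ (↑U : Set (Sym2 V))ᶜ ∈ S)
    (hSW : ∀ ξ ∈ S, ξ ⊆ G.edgeSet → Disjoint ξ (↑U : Set (Sym2 V)) →
      ∀ x ∈ W₀, ∀ y ∈ W₀, (fromEdgeSet ξ ⊔ wired B).Reachable x y) :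
    (rcMeasure (fromEdgeSet (U : Set (Sym2 V))) p q W₀).real A * (rcMeasure G p q B).real S ≤
      (rcMeasure G p q B).real (A ∩ S) := by
  have hq0 : 0 < q := one_pos.trans_le hq
  set μ := rcMeasure G p q B with hμ
  set ν := rcMeasure (fromEdgeSet (U : Set (Sym2 V))) p q W₀ with hν
  haveI : IsProbabilityMeasure μ := isProbabilityMeasure_rcMeasure G hp hq0 B
  haveI : IsProbabilityMeasure ν := isProbabilityMeasure_rcMeasure _ hp hq0 W₀
  rw [measureReal_eq_sum_inter_offCylinder μ ↑U S, measureReal_eq_sum_inter_offCylinder μ ↑U (A ∩ S),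
    Finset.mul_sum]
  refine Finset.sum_le_sum fun ξ _ => ?_
  by_cases hξ : ξ ∈ S
  · rw [inter_offCylinder_eq_of_mem hS hξ, show S ∩ {ω | ω ∩ (↑U : Set (Sym2 V))ᶜ = ξ} =
        Set.univ ∩ S ∩ {ω | ω ∩ (↑U : Set (Sym2 V))ᶜ = ξ} by rw [Set.univ_inter],
      inter_offCylinder_eq_of_mem hS hξ, Set.univ_inter]
    by_cases hξE : ξ ⊆ G.edgeSet
    · by_cases hξU : Disjoint ξ (↑U : Set (Sym2 V))
      · have hdom := rcMeasure_real_cylinder_mul_fromEdgeSet_le_of_reachable G hp hq B U hU ξ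
          (hSW ξ hξ hξE hξU) hA
        have hAe : {ω : BondConfig V | ω ∩ ↑U ∈ A} = A := by
          ext ω; simp only [Set.mem_setOf_eq, ← hAU ω]
        rw [hAe] at hdom
        rw [mul_comm]
        exact hdom
      · -- the cylinder is empty: `ω ∖ U = ξ` forces `ξ ∩ U = ∅`
        have hC : {ω : BondConfig V | ω ∩ (↑U : Set (Sym2 V))ᶜ = ξ} = ∅ := by
          ext ω
          simp only [Set.mem_setOf_eq, Set.mem_empty_iff_false, iff_false]
          intro hω
          apply hξU
          rw [← hω]
          exact Set.disjoint_left.2 fun e he heU => he.2 heU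
        rw [hC, Set.inter_empty, measureReal_empty, mul_zero]
    · rw [rcMeasure_real_offCylinder_eq_zero_of_not_subset G hp hq0 B hξE,
        show ({ω : BondConfig V | ω ∩ (↑U : Set (Sym2 V))ᶜ = ξ}) =
          Set.univ ∩ {ω | ω ∩ (↑U : Set (Sym2 V))ᶜ = ξ} by rw [Set.univ_inter],
        rcMeasure_real_offCylinder_eq_zero_of_not_subset G hp hq0 B hξE, mul_zero]
  · rw [inter_offCylinder_eq_empty_of_notMem hS hξ, show S ∩ {ω | ω ∩ (↑U : Set (Sym2 V))ᶜ = ξ} =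
        Set.univ ∩ S ∩ {ω | ω ∩ (↑U : Set (Sym2 V))ᶜ = ξ} by rw [Set.univ_inter],
      inter_offCylinder_eq_empty_of_notMem hS hξ, measureReal_empty, mul_zero]

/-- **Upper bound for decreasing events crediting history-forced wiring**: with `U`, `S`, `W₀` as in
`rcMeasure_fromEdgeSet_real_mul_le_real_inter_of_reachable` and a decreasing event `D` determined by the edges of
`U`, `φ^B_{G,p,q}(D ∩ S) ≤ φ^{W₀}_{⟨U⟩,p,q}(D) · φ^B_{G,p,q}(S)` (`q ≥ 1`): given a history that wires the
seed, a decreasing event of the fresh region is at most as likely as under the region's measure with the seed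
wired. [cite: Grimmett2006, Lemma (4.13) and Lemma (4.14)(b)] -/
theorem rcMeasure_real_inter_le_fromEdgeSet_real_mul_of_isLowerSet_of_reachable {p q : ℝ}
    (hp : p ∈ Set.Icc (0 : ℝ) 1) (hq : 1 ≤ q) (B : Set V) (U : Finset (Sym2 V)) (hU : U ⊆ G.edgeFinset)
    {W₀ : Set V} {D S : Set (BondConfig V)} (hD : IsLowerSet D) (hDU : ∀ ω, ω ∈ D ↔ ω ∩ ↑U ∈ D)
    (hS : ∀ ω, ω ∈ S ↔ ω ∩ (↑U : Set (Sym2 V))ᶜ ∈ S)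
    (hSW : ∀ ξ ∈ S, ξ ⊆ G.edgeSet → Disjoint ξ (↑U : Set (Sym2 V)) →
      ∀ x ∈ W₀, ∀ y ∈ W₀, (fromEdgeSet ξ ⊔ wired B).Reachable x y) :
    (rcMeasure G p q B).real (D ∩ S) ≤
      (rcMeasure (fromEdgeSet (U : Set (Sym2 V))) p q W₀).real D * (rcMeasure G p q B).real S := by
  have hq0 : 0 < q := one_pos.trans_le hq
  set μ := rcMeasure G p q B with hμ
  set ν := rcMeasure (fromEdgeSet (U : Set (Sym2 V))) p q W₀ with hν
  haveI : IsProbabilityMeasure μ := isProbabilityMeasure_rcMeasure G hp hq0 B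
  haveI : IsProbabilityMeasure ν := isProbabilityMeasure_rcMeasure _ hp hq0 W₀
  -- the complement `Dᶜ` is increasing and determined by `U`
  have hDc : IsUpperSet Dᶜ := hD.compl
  have hDcU : ∀ ω, ω ∈ Dᶜ ↔ ω ∩ ↑U ∈ Dᶜ := fun ω => not_congr (hDU ω)
  have h := rcMeasure_fromEdgeSet_real_mul_le_real_inter_of_reachable G hp hq B U hU hDc hDcU hS hSW
  rw [← hμ, ← hν] at h
  have h1 : μ.real (Dᶜ ∩ S) = μ.real S - μ.real (D ∩ S) := by
    have h0 : μ.real (S ∩ D) + μ.real (S \ D) = μ.real S :=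
      measureReal_inter_add_sdiff (s := S) MeasurableSet.of_discrete
    rw [Set.sdiff_eq_compl_inter, Set.inter_comm S D] at h0
    linarith
  have h2 : ν.real Dᶜ = 1 - ν.real D := probReal_compl_eq_one_sub MeasurableSet.of_discrete
  rw [h1, h2] at h
  nlinarith [h, measureReal_nonneg (μ := μ) (s := S)]

/-! ### The spanning graph of all edges -/

omit [Fintype V] [DecidableEq V] in
/-- Mapping a finite set of pairs along the identity embedding does nothing. [folklore] -/
theorem map_sym2Map_refl (ω : Finset (Sym2 V)) : ω.map (Function.Embedding.refl V).sym2Map = ω := by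
  ext e
  simp only [Finset.mem_map, Function.Embedding.sym2Map_apply, Function.Embedding.coe_refl, Sym2.map_id', id_eq,
    exists_eq_right]

/-- `φ^W_{⟨E(G)⟩,p,q} = φ^W_{G,p,q}`: the random-cluster measure only depends on the edge set (the spanning graph
`fromEdgeSet E(G)` has the edges of `G`). [cite: Grimmett2006, §1.2 eq. (1.2)] -/
theorem rcMeasure_fromEdgeSet_edgeFinset_real {p q : ℝ} (hp : p ∈ Set.Icc (0 : ℝ) 1) (hq : 0 < q) (W : Set V)
    (A : Set (BondConfig V)) :
    (rcMeasure (fromEdgeSet (↑G.edgeFinset : Set (Sym2 V))) p q W).real A = (rcMeasure G p q W).real A := by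
  have hE : ∀ i : Fintype (fromEdgeSet (↑G.edgeFinset : Set (Sym2 V))).edgeSet,
      @SimpleGraph.edgeFinset V (fromEdgeSet (↑G.edgeFinset : Set (Sym2 V))) i =
        G.edgeFinset.map (Function.Embedding.refl V).sym2Map := fun i => by
    rw [map_sym2Map_refl]; exact @edgeFinset_fromEdgeSet_of_subset V _ G _ G.edgeFinset le_rfl i
  have h := rcMeasure_real_map_image (Function.Embedding.refl V) (G := G)
    (G' := fromEdgeSet (↑G.edgeFinset : Set (Sym2 V))) (hE _) hp hq W (A := A) (A' := A)
    (fun ω _ => by rw [map_sym2Map_refl])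
  rw [Function.Embedding.coe_refl, Set.image_id] at h
  exact h

end Finite

/-! ### An edge-set region of `ℤ^d` inside a larger piece: bookkeeping, transport, open paths -/

section Lattice

open Finset SimpleGraph

variable {d : ℕ}

/-- A pair of vertices of the piece `Λ` is an edge of `(Λ, E_Λ)` iff its underlying lattice pair is a lattice edge.
[cite: Grimmett2006, §4.2 (E_Λ)] -/
theorem mem_edgeFinset_finsetGraph_iff {Λ : Finset (Site d)} (e : Sym2 ↥Λ) :
    e ∈ (finsetGraph (zdGraph d) Λ).edgeFinset ↔ Sym2.map Subtype.val e ∈ (zdGraph d).edgeSet := by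
  induction e using Sym2.ind with
  | h a b => rw [mem_edgeFinset, SimpleGraph.mem_edgeSet, finsetGraph_adj_iff, Sym2.map_mk, SimpleGraph.mem_edgeSet]

/-- Lifting an edge of `Λ` into `Δ ⊇ Λ` does not change the underlying lattice pair. [folklore] -/
theorem map_val_edgeLift {Λ Δ : Finset (Site d)} (h : Λ ⊆ Δ) (e : Sym2 ↥Λ) :
    Sym2.map Subtype.val (edgeLift h e) = Sym2.map Subtype.val e := by
  induction e using Sym2.ind with
  | h a b => rw [edgeLift_mk, Sym2.map_mk, Sym2.map_mk]; rfl

/-- The lifted copy of a set of edges of `(Λ, E_Λ)` consists of edges of `(Δ, E_Δ)`. [cite: Grimmett2006, §4.2] -/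
theorem map_edgeLift_subset_edgeFinset {Λ Δ : Finset (Site d)} (h : Λ ⊆ Δ) {R : Finset (Sym2 ↥Λ)}
    (hR : R ⊆ (finsetGraph (zdGraph d) Λ).edgeFinset) :
    R.map (edgeLift h) ⊆ (finsetGraph (zdGraph d) Δ).edgeFinset :=
  (Finset.map_subset_map.2 hR).trans (insideEdges_subset_edgeFinset h)

/-- A pair of `Δ` whose underlying lattice pair belongs to the lattice image `F ⊆ E_Λ` of `R` is a lifted edge of
`R`. [cite: Grimmett2006, §4.2] -/
theorem mem_map_edgeLift_of_map_val_mem {Λ Δ : Finset (Site d)} (h : Λ ⊆ Δ) {R : Finset (Sym2 ↥Λ)}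
    {F : Finset (Sym2 (Site d))} (hF : (↑F : Set (Sym2 (Site d))) ⊆ ↑(edgesIn (zdGraph d) Λ))
    (hFR : ∀ e : Sym2 ↥Λ, e ∈ R ↔ Sym2.map Subtype.val e ∈ F) {e : Sym2 ↥Δ}
    (he : Sym2.map Subtype.val e ∈ F) : e ∈ R.map (edgeLift h) := by
  have heΛ : e ∈ insideEdges (zdGraph d) h :=
    (mem_insideEdges_iff_map_val_mem_edgesIn h e).2 (Finset.mem_coe.1 (hF (Finset.mem_coe.2 he)))
  obtain ⟨e', -, rfl⟩ := Finset.mem_map.1 heΛ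
  rw [map_val_edgeLift] at he
  exact Finset.mem_map.2 ⟨e', (hFR e').2 he, rfl⟩

/-- **Transport of an edge-set region with a wired seed**: for `Λ ⊆ Δ`, a set `R` of edges of `(Λ, E_Λ)` and a seed
`W ⊆ Λ`, the measure of the spanning graph of the lifted edges `R.map (edgeLift h)` on `Δ` with the copy `j(W)` of
`W` wired (`j : Λ ↪ Δ` the inclusion; all other vertices idle, unwired), on the pull-back of a `ℤ^d`-event, equals
`φ^W_{⟨R⟩,p,q}` read through `liftEdges Λ` (tree `rcMeasure_real_map_image`: idle vertices contribute a constant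
power of `q`). [cite: Grimmett2006, Lemma (4.13)] -/
theorem rcMeasure_fromEdgeSet_map_edgeLift_real {p q : ℝ} (hp : p ∈ Set.Icc (0 : ℝ) 1) (hq : 0 < q)
    {Λ Δ : Finset (Site d)} (h : Λ ⊆ Δ) {R : Finset (Sym2 ↥Λ)} (hR : R ⊆ (finsetGraph (zdGraph d) Λ).edgeFinset)
    (W : Set ↥Λ) (A : Set (BondConfig (Site d))) :
    (rcMeasure (fromEdgeSet (↑(R.map (edgeLift h)) : Set (Sym2 ↥Δ))) p q (finsetInclEmb h '' W)).real
        (liftEdges Δ ⁻¹' A) =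
      (rcMeasure (fromEdgeSet (↑R : Set (Sym2 ↥Λ))) p q W).real (liftEdges Λ ⁻¹' A) := by
  have hEΔ : ∀ i : Fintype (fromEdgeSet (↑(R.map (edgeLift h)) : Set (Sym2 ↥Δ))).edgeSet,
      @SimpleGraph.edgeFinset _ (fromEdgeSet (↑(R.map (edgeLift h)) : Set (Sym2 ↥Δ))) i = R.map (edgeLift h) :=
    fun i => @edgeFinset_fromEdgeSet_of_subset _ _ (finsetGraph (zdGraph d) Δ) _ _
      (map_edgeLift_subset_edgeFinset h hR) i
  have hEΛ : ∀ i : Fintype (fromEdgeSet (↑R : Set (Sym2 ↥Λ))).edgeSet,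
      @SimpleGraph.edgeFinset _ (fromEdgeSet (↑R : Set (Sym2 ↥Λ))) i = R :=
    fun i => @edgeFinset_fromEdgeSet_of_subset _ _ (finsetGraph (zdGraph d) Λ) _ R hR i
  refine rcMeasure_real_map_image (finsetInclEmb h) (G := fromEdgeSet (↑R : Set (Sym2 ↥Λ)))
    (G' := fromEdgeSet (↑(R.map (edgeLift h)) : Set (Sym2 ↥Δ))) ?_ hp hq W (A := liftEdges Λ ⁻¹' A)
    (A' := liftEdges Δ ⁻¹' A) (fun ω _ => ?_)
  · rw [hEΔ, hEΛ]
  · rw [Set.mem_preimage, Set.mem_preimage, liftEdges_coe_map_edgeLift h ω]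

/-- **Pulling an open path of `ℤ^d` back to the finite piece**: if `x, y : Δ` are joined by a path of open edges of
the lifted configuration `liftEdges Δ ξ` (an event of `ℤ^d`), they are joined in `⟨ξ⟩` on `Δ` (every edge of the
lifted configuration is the image of an edge of `ξ`, whose endpoints lie in `Δ`). [cite: Grimmett2006, §4.2] -/
theorem reachable_of_mem_openConn_liftEdges {Δ : Finset (Site d)} {ξ : BondConfig ↥Δ} {x y : ↥Δ}
    (h : liftEdges Δ ξ ∈ openConn (x : Site d) (y : Site d)) : (fromEdgeSet ξ).Reachable x y := by
  -- induction along a walk of `openGraph (liftEdges Δ ξ)`, keeping track of membership in `Δ`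
  have key : ∀ (a b : Site d) (w : (openGraph (liftEdges Δ ξ)).Walk a b) (ha : a ∈ Δ) (hb : b ∈ Δ),
      (fromEdgeSet ξ).Reachable ⟨a, ha⟩ ⟨b, hb⟩ := by
    intro a b w
    induction w with
    | nil => intro ha hb; exact Reachable.refl _
    | @cons a c b hadj w ih =>
      intro ha hb
      rw [openGraph_adj] at hadj
      obtain ⟨hmem, hne⟩ := hadj
      rw [mem_liftEdges_iff] at hmem
      obtain ⟨e', he', hmap⟩ := hmem
      -- the edge `e' ∈ ξ` has endpoints `a, c` (in some order), so `c ∈ Δ` and `⟨a⟩ ~ ⟨c⟩` in `⟨ξ⟩`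
      induction e' using Sym2.ind with
      | h u v =>
        rw [Sym2.map_mk, Sym2.eq_iff] at hmap
        have hc : c ∈ Δ := by
          rcases hmap with ⟨-, h2⟩ | ⟨h1, -⟩
          · rw [← h2]; exact v.2
          · rw [← h1]; exact u.2
        have hadj' : (fromEdgeSet ξ).Adj ⟨a, ha⟩ ⟨c, hc⟩ := by
          rw [fromEdgeSet_adj]
          refine ⟨?_, fun heq => hne (congrArg Subtype.val heq)⟩
          rcases hmap with ⟨h1, h2⟩ | ⟨h1, h2⟩
          · have hu : u = ⟨a, ha⟩ := Subtype.ext h1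
            have hv : v = ⟨c, hc⟩ := Subtype.ext h2
            rw [← hu, ← hv]; exact he'
          · have hu : u = ⟨c, hc⟩ := Subtype.ext h1
            have hv : v = ⟨a, ha⟩ := Subtype.ext h2
            rw [Sym2.eq_swap, ← hu, ← hv]; exact he'
        exact hadj'.reachable.trans (ih hc hb)
  obtain ⟨w⟩ := h
  exact key _ _ w x.2 y.2

end Lattice

end Summit.CriticalPhenomena.PercolationContinuityZ3.Theorems.FK

end
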